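import Literature.NumberTheory.PAdicHodge.BdRUnramified
import Literature.NumberTheory.Automorphic.LParameter
import HarnessLib

/-!
# The `p`-adic Hodge data ON Fontaine's `B_dR(F)` form an inhabited type

Let `F` be a non-archimedean local field of characteristic `0` with `v(p) < 1`.  The accepted
structure `PstWeilDeligneData F p` (file `GaloisRepresentations/PstWeilDeligne`) bundles a
`ℚ_p`-algebra structure on `F`, a period-ring datum `𝔅` (INTENDED `B_dR(F)`) and a relation
`IsWeilDeligneOf ρ r` (INTENDED `r ≅ WD(D_pst ρ)`) subject to five structure axioms.  The tree now
contains the GENUINE period ring, `bdRPeriodRingData hp` (file `BdRPeriodRingData`: Fontaine's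
`B_dR(F) = Frac B_dR⁺(F)`, `B_dR^{Γ_F} = F` by Ax–Sen–Tate), for which unramified representations
are de Rham (file `BdRUnramified`).  This file proves ONE theorem:

* `nonempty_pstWeilDeligneData_bdR hp` — **the type of data whose `ℚ_p`-structure is the given one
  and whose period ring IS `bdRPeriodRingData hp` is inhabited.**  Witness (inside the proof, not a
  definition): the datum on `B_dR` with the NAIVE Weil–Deligne relation — for UNRAMIFIED `ρ`,
  `r ≅ (ρ|_{W_F}, N = 0)` (which is Fontaine's `WD(D_pst ρ)` there: Exp. VIII §1.3, §2.3.7 with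
  Exp. III §5; the normalisation of clause (F8) of `IsFontaineDatum`); for ramified `ρ`, `r ≅` the
  trivial Weil–Deligne representation (a placeholder — the genuine `WD ∘ D_pst` on ramified de Rham
  representations is the definition item D2).  Its five structure axioms are theorems (existence,
  uniqueness up to isomorphism, frame invariance via `FramedRep.weilRestrictConjEquiv`, unramified ⇒
  de Rham for `B_dR` = `FramedRep.isDeRhamWith_bdR_of_isLocallyUnramified`, and `N = 0` with inertia
  trivial on `WD` of unramified `ρ`).

PURPOSE: the `Nonempty` witness for Hilbert's `ε` over the data ON `B_dR` in the D1 upgrade of the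
pinned datum `fontainePst` (`FontaineDpst`, Upgrade path), exactly as the accepted truncated model
`unramifiedPstWeilDeligneData` serves `Nonempty (PstWeilDeligneData F p)` today.  The witness is
NOT claimed to satisfy Fontaine's clauses `IsFontaineDatum`.  No definitions, no named facts.

## References
* [FontaineAsterisque223III] J.-M. Fontaine, Astérisque 223 (1994), Exp. III §3, §5; Exp. VIII §1.3, §2.3.7.
* [TateCorvallis1979] J. Tate, *Number theoretic background*, Corvallis 1979, (4.1.3), (4.1.6).
-/

noncomputable section

open Field ValuativeRel
open scoped MatrixGroups

namespace Literature.NumberTheory.PAdicHodge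

open Literature.NumberTheory.GaloisRepresentations
open Literature.NumberTheory.GaloisRepresentations.IsNonarchimedeanLocalField

variable {F : Type} [Field F] [ValuativeRel F] [TopologicalSpace F] [IsNonarchimedeanLocalField F]
  {p : ℕ} [Fact p.Prime]

/-- Unramifiedness of a framed representation does not see the frame. [folklore] -/
theorem _root_.Literature.NumberTheory.GaloisRepresentations.FramedRep.isLocallyUnramified_conj_iff
    {n : ℕ} (g : GL (Fin n) (PadicAlgCl p)) (ρ : FramedRep (absoluteGaloisGroup F) (PadicAlgCl p) n) :
    (FramedRep.conj g ρ).IsLocallyUnramified ↔ ρ.IsLocallyUnramified := by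
  refine ⟨fun h σ hσ => ?_, fun h σ hσ => ?_⟩
  · have h1 := h σ hσ
    rw [FramedRep.conj_apply, mul_inv_eq_one, mul_eq_left] at h1
    exact h1
  · rw [FramedRep.conj_apply, h σ hσ, mul_one, mul_inv_cancel]

variable [CharZero F] [Fact (¬ IsUnit (p : integerC F))]
  [IsAdicComplete (Ideal.span {(p : integerC F)}) (integerC F)] [Algebra ℚ_[p] F]

-- Mathlib's own global value of `maxSynthPendingDepth`.
set_option maxSynthPendingDepth 3 in
/-- **The `p`-adic Hodge data ON `B_dR(F)` form an inhabited type**: there is a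
`𝔇 : PstWeilDeligneData F p` with `𝔇.algebra` the given `ℚ_p`-structure and `𝔇.𝔅 = bdRPeriodRingData hp`
(Fontaine's `B_dR(F)`).  Witness: the naive Weil–Deligne relation (unramified `ρ ↦ (ρ|_{W_F}, 0)`,
Fontaine Exp. VIII §1.3 / Tate (4.1.3); ramified `ρ ↦` trivial, a placeholder for `WD ∘ D_pst`), whose
five structure axioms are theorems — unramified ⇒ de Rham being Fontaine's theorem for the genuine
ring (`FramedRep.isDeRhamWith_bdR_of_isLocallyUnramified`).  The `Nonempty` witness of the D1
upgrade of `fontainePst`; not asserted to satisfy `IsFontaineDatum`.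
[cite: FontaineAsterisque223III, Exp. III §3 and §5] [cite: TateCorvallis1979, (4.1.3)] -/
theorem nonempty_pstWeilDeligneData_bdR (hp : valuation F p < 1) :
    Nonempty {𝔇 : PstWeilDeligneData F p // 𝔇.algebra = ‹Algebra ℚ_[p] F› ∧
      𝔇.𝔅 = (letI := 𝔇.algebra; bdRPeriodRingData (F := F) (p := p) hp)} := by
  -- the naive Weil–Deligne relation
  let R : ∀ {n : ℕ}, FramedRep (absoluteGaloisGroup F) (PadicAlgCl p) n →
      WeilDeligneRep F (PadicAlgCl p) (Fin n → PadicAlgCl p) → Prop := fun {n} ρ r =>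
    (ρ.IsLocallyUnramified ∧ r.N = 0 ∧ Nonempty (Representation.Equiv r.ρ (ρ.weilRestrict F))) ∨
      (¬ ρ.IsLocallyUnramified ∧
        r.IsEquivalent (WeilDeligneRep.trivial (PadicAlgCl p) (Fin n → PadicAlgCl p)))
  refine ⟨⟨{ algebra := ‹Algebra ℚ_[p] F›
             𝔅 := bdRPeriodRingData (F := F) (p := p) hp
             IsWeilDeligneOf := R
             exists_of_isDeRham := ?_
             isEquivalent := ?_
             conj := ?_
             isDeRhamWith_of_isLocallyUnramified := fun ρ h =>
               ρ.isDeRhamWith_bdR_of_isLocallyUnramified hp h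
             wd_of_isLocallyUnramified := ?_ }, rfl, rfl⟩⟩
  · -- existence
    intro n ρ _
    by_cases hu : ρ.IsLocallyUnramified
    · exact ⟨WeilDeligneRep.ofRep (ρ.weilRestrict F) hu.isUnramifiedRep_weilRestrict.isContinuousRep,
        Or.inl ⟨hu, rfl, ⟨Representation.Equiv.refl _⟩⟩⟩
    · exact ⟨WeilDeligneRep.trivial (PadicAlgCl p) (Fin n → PadicAlgCl p),
        Or.inr ⟨hu, WeilDeligneRep.IsEquivalent.refl _⟩⟩
  · -- uniqueness up to isomorphism
    intro n ρ r r' h h'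
    rcases h with ⟨hu, hN, ⟨e⟩⟩ | ⟨hu, he⟩
    · rcases h' with ⟨_, hN', ⟨e'⟩⟩ | ⟨hu', _⟩
      · exact ⟨{ toRepEquiv := e.trans e'.symm
                 comm_N := by rw [hN, hN', LinearMap.comp_zero, LinearMap.zero_comp] }⟩
      · exact absurd hu hu'
    · rcases h' with ⟨hu', _, _⟩ | ⟨_, he'⟩
      · exact absurd hu' hu
      · exact he.trans he'.symm
  · -- frame invariance
    intro n g ρ r h
    rcases h with ⟨hu, hN, ⟨e⟩⟩ | ⟨hu, he⟩
    · exact Or.inl ⟨(FramedRep.isLocallyUnramified_conj_iff g ρ).2 hu, hN,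
        ⟨e.trans (FramedRep.weilRestrictConjEquiv g ρ)⟩⟩
    · exact Or.inr ⟨fun h => hu ((FramedRep.isLocallyUnramified_conj_iff g ρ).1 h), he⟩
  · -- `N = 0`, inertia trivial on `WD` of unramified `ρ`
    intro n ρ r hρ h
    rcases h with ⟨_, hN, ⟨e⟩⟩ | ⟨hu, _⟩
    · refine ⟨hN, fun u hu => LinearMap.ext fun v => ?_⟩
      have h1 := Representation.IntertwiningMap.isIntertwining _ _ e.toIntertwiningMap u v
      rw [hρ.isUnramifiedRep_weilRestrict u hu] at h1
      exact e.injective h1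
    · exact absurd hρ hu

end Literature.NumberTheory.PAdicHodge

end
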